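import Mathlib.Algebra.BigOperators.Ring.Finset
import Mathlib.Algebra.Group.Pointwise.Finset.Basic
import Mathlib.Algebra.Field.ZMod
import Mathlib.Tactic.Abel
import Mathlib.Tactic.Ring
import Mathlib.Tactic.Linarith
import Mathlib.Tactic.LinearCombination
import Summits.MatrixMultiplication.OmegaCensus.ThreeSetLineSymmetry
import Summits.MatrixMultiplication.OmegaCensus.ThreeSetAffineSpan
import HarnessLib

/-!
# A part of size three over `ℤ_p × ℤ_p` is a non-degenerate triangle: normal form `W = {0, e₁, e₂}`

ω-census `pub-omega`, family (b3), seat pub-omega-group gen 32.  Framing: lottery ticket; floor = certified bounds/negative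
ranges.  VALUE: kernel structure theorems about the group-theoretic method (three-set cube law triples in dihedral-like
groups over `ℤ_p²`); NOT progress on ω.  Continuation of `ThreeSetAffineSpan.lean` (the coset lemma).

* `cube_symmetric_form_rotate` — the cube symmetric form is invariant under `(W, X, Y) ↦ (X, Y, W)` (so every statement
  about the part `W` holds for all three parts); `cube_symmetric_form_map` — invariance under group isomorphisms
  `σ : A ≃+ B` (with `ThreeSetLineSymmetry.cube_symmetric_form_translate`: under the affine group `A ⋊ Aut A`).
* `det_ne_zero_of_cube_form` — over `ℤ_p × ℤ_p`, a part `W = {0, u, v}` of size `3` has `u₁v₂ − u₂v₁ ≠ 0` (else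
  `0, u, v` lie in the kernel of a non-zero functional, a proper subgroup, contradicting the coset lemma).
* **`cube_form_part_three_normal_form`** — hence a linear change of coordinates gives a cube symmetric form with the same
  part sizes and `W = {0, (1,0), (0,1)}`: the punctured torus `ℤ_p² ∖ {x₀}` is partitioned into `2|X||Y|` up-triangles
  `{0,e₁,e₂} + t` (`t ∈ (Y − X) ⊔ (X − Y)`) and `|X||Y|` down-triangles `−{0,e₁,e₂} + m` (`m ∈ X + Y`).  This is the
  bridge from the census objects (cells `(3,d,e)@p²`) to the cell's internal, unproved Conjecture T (RESULTS-g31 §3: no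
  partition of `ℤ_p² ∖ {pt}` into translates of `{0,e₁,e₂}` and `{0,−e₁,−e₂}` has `#up − #down = (p² − 1)/9`), which
  would exclude parts of size `3` over `ℤ_p²` for every prime `p`.
* `nine_mul_card_add_one_eq_sq` — `9|X||Y| + 1 = p²`, so `p ≡ ±1 (mod 9)` is necessary for a part of size `3`.

No new definitions.
-/

namespace Summit.MatrixMultiplication.OmegaCensus

open Finset

section Symmetry

variable {A B : Type*} [AddCommGroup A] [DecidableEq A] [AddCommGroup B] [DecidableEq B]

omit [AddCommGroup A] [DecidableEq A] in
/-- Transfer of injectivity along a reindexing `e` of the box with `f' ∘ e = f`. [folklore] -/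
theorem injOn_image_of_comp {ι κ : Type*} [DecidableEq κ] {s : Finset ι} {e : ι → κ} {f : ι → A} {f' : κ → A}
    (hfe : ∀ i, f' (e i) = f i) (hf : Set.InjOn f ↑s) : Set.InjOn f' ↑(s.image e) := by
  rw [coe_image]
  rintro _ ⟨i, hi, rfl⟩ _ ⟨j, hj, rfl⟩ h
  rw [hfe, hfe] at h
  rw [hf hi hj h]

omit [AddCommGroup A] in
/-- Images along a reindexing `e` of the box with `f' ∘ e = f`. [folklore] -/
theorem image_image_of_comp {ι κ : Type*} [DecidableEq κ] (s : Finset ι) {e : ι → κ} {f : ι → A}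
    {f' : κ → A} (hfe : ∀ i, f' (e i) = f i) : (s.image e).image f' = s.image f := by
  rw [image_image]; exact image_congr fun i _ => hfe i

omit [AddCommGroup A] in
/-- Rotating the box: `X ×ˢ Y ×ˢ W` is the image of `W ×ˢ X ×ˢ Y` under `(w,x,y) ↦ (x,y,w)`. [folklore] -/
theorem product₃_rotate (W X Y : Finset A) :
    X ×ˢ Y ×ˢ W = (W ×ˢ X ×ˢ Y).image fun p : A × A × A => (p.2.1, p.2.2, p.1) := by
  ext ⟨x, y, w⟩
  simp only [mem_product, mem_image, Prod.mk.injEq]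
  constructor
  · rintro ⟨hx, hy, hw⟩; exact ⟨(w, x, y), ⟨hw, hx, hy⟩, rfl, rfl, rfl⟩
  · rintro ⟨⟨w', x', y'⟩, ⟨hw', hx', hy'⟩, rfl, rfl, rfl⟩; exact ⟨hx', hy', hw'⟩

variable [Fintype A]

/-- **Rotation symmetry of the cube symmetric form**: `(W, X, Y, x₀) ↦ (X, Y, W, x₀)`.  The three signed sums of the
rotated triple are the old ones in the order `(2, 3, 1)`, so the coset lemma and its consequences apply to every part.
[folklore] -/
theorem cube_symmetric_form_rotate {W X Y : Finset A} {x₀ : A}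
    (h₁ : Set.InjOn (fun p : A × A × A => -p.1 + p.2.1 + p.2.2) ↑(W ×ˢ X ×ˢ Y))
    (h₂ : Set.InjOn (fun p : A × A × A => p.1 - p.2.1 + p.2.2) ↑(W ×ˢ X ×ˢ Y))
    (h₃ : Set.InjOn (fun p : A × A × A => p.1 + p.2.1 - p.2.2) ↑(W ×ˢ X ×ˢ Y))
    (d₁₂ : Disjoint ((W ×ˢ X ×ˢ Y).image fun p : A × A × A => -p.1 + p.2.1 + p.2.2)
      ((W ×ˢ X ×ˢ Y).image fun p : A × A × A => p.1 - p.2.1 + p.2.2))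
    (d₁₃ : Disjoint ((W ×ˢ X ×ˢ Y).image fun p : A × A × A => -p.1 + p.2.1 + p.2.2)
      ((W ×ˢ X ×ˢ Y).image fun p : A × A × A => p.1 + p.2.1 - p.2.2))
    (d₂₃ : Disjoint ((W ×ˢ X ×ˢ Y).image fun p : A × A × A => p.1 - p.2.1 + p.2.2)
      ((W ×ˢ X ×ˢ Y).image fun p : A × A × A => p.1 + p.2.1 - p.2.2))
    (hcover : ((W ×ˢ X ×ˢ Y).image fun p : A × A × A => -p.1 + p.2.1 + p.2.2) ∪
      ((W ×ˢ X ×ˢ Y).image fun p : A × A × A => p.1 - p.2.1 + p.2.2) ∪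
      ((W ×ˢ X ×ˢ Y).image fun p : A × A × A => p.1 + p.2.1 - p.2.2) = univ.erase x₀) :
    Set.InjOn (fun p : A × A × A => -p.1 + p.2.1 + p.2.2) ↑(X ×ˢ Y ×ˢ W) ∧
    Set.InjOn (fun p : A × A × A => p.1 - p.2.1 + p.2.2) ↑(X ×ˢ Y ×ˢ W) ∧
    Set.InjOn (fun p : A × A × A => p.1 + p.2.1 - p.2.2) ↑(X ×ˢ Y ×ˢ W) ∧
    Disjoint ((X ×ˢ Y ×ˢ W).image fun p : A × A × A => -p.1 + p.2.1 + p.2.2)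
      ((X ×ˢ Y ×ˢ W).image fun p : A × A × A => p.1 - p.2.1 + p.2.2) ∧
    Disjoint ((X ×ˢ Y ×ˢ W).image fun p : A × A × A => -p.1 + p.2.1 + p.2.2)
      ((X ×ˢ Y ×ˢ W).image fun p : A × A × A => p.1 + p.2.1 - p.2.2) ∧
    Disjoint ((X ×ˢ Y ×ˢ W).image fun p : A × A × A => p.1 - p.2.1 + p.2.2)
      ((X ×ˢ Y ×ˢ W).image fun p : A × A × A => p.1 + p.2.1 - p.2.2) ∧
    ((X ×ˢ Y ×ˢ W).image fun p : A × A × A => -p.1 + p.2.1 + p.2.2) ∪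
      ((X ×ˢ Y ×ˢ W).image fun p : A × A × A => p.1 - p.2.1 + p.2.2) ∪
      ((X ×ˢ Y ×ˢ W).image fun p : A × A × A => p.1 + p.2.1 - p.2.2) = univ.erase x₀ := by
  have c₁ : ∀ p : A × A × A, (fun p : A × A × A => -p.1 + p.2.1 + p.2.2) (p.2.1, p.2.2, p.1) =
      (fun p : A × A × A => p.1 - p.2.1 + p.2.2) p := fun p => by simp only; abel
  have c₂ : ∀ p : A × A × A, (fun p : A × A × A => p.1 - p.2.1 + p.2.2) (p.2.1, p.2.2, p.1) =
      (fun p : A × A × A => p.1 + p.2.1 - p.2.2) p := fun p => by simp only; abel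
  have c₃ : ∀ p : A × A × A, (fun p : A × A × A => p.1 + p.2.1 - p.2.2) (p.2.1, p.2.2, p.1) =
      (fun p : A × A × A => -p.1 + p.2.1 + p.2.2) p := fun p => by simp only; abel
  rw [product₃_rotate, image_image_of_comp _ c₁, image_image_of_comp _ c₂, image_image_of_comp _ c₃]
  refine ⟨injOn_image_of_comp c₁ h₂, injOn_image_of_comp c₂ h₃, injOn_image_of_comp c₃ h₁, d₂₃,
    d₁₂.symm, d₁₃.symm, ?_⟩
  rw [← hcover]; ext a; simp only [mem_union]; tauto

variable [Fintype B]

omit [DecidableEq A] [Fintype A] [Fintype B] in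
/-- The box of the images under an additive map is the image of the box. [folklore] -/
theorem product₃_image_map (σ : A →+ B) (W X Y : Finset A) :
    (W.image σ) ×ˢ (X.image σ) ×ˢ (Y.image σ) =
      (W ×ˢ X ×ˢ Y).image fun p : A × A × A => (σ p.1, σ p.2.1, σ p.2.2) := by
  ext ⟨w, x, y⟩
  simp only [mem_product, mem_image, Prod.mk.injEq]
  constructor
  · rintro ⟨⟨w', hw', rfl⟩, ⟨x', hx', rfl⟩, ⟨y', hy', rfl⟩⟩
    exact ⟨(w', x', y'), ⟨hw', hx', hy'⟩, rfl, rfl, rfl⟩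
  · rintro ⟨⟨w', x', y'⟩, ⟨hw', hx', hy'⟩, rfl, rfl, rfl⟩
    exact ⟨⟨w', hw', rfl⟩, ⟨x', hx', rfl⟩, ⟨y', hy', rfl⟩⟩

/-- **Invariance of the cube symmetric form under group isomorphisms** `σ : A ≃+ B`: `(W, X, Y, x₀) ↦ (σW, σX, σY, σx₀)`.
Together with `cube_symmetric_form_translate` this is invariance under the affine group `A ⋊ Aut A`. [folklore] -/
theorem cube_symmetric_form_map (σ : A ≃+ B) {W X Y : Finset A} {x₀ : A}
    (h₁ : Set.InjOn (fun p : A × A × A => -p.1 + p.2.1 + p.2.2) ↑(W ×ˢ X ×ˢ Y))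
    (h₂ : Set.InjOn (fun p : A × A × A => p.1 - p.2.1 + p.2.2) ↑(W ×ˢ X ×ˢ Y))
    (h₃ : Set.InjOn (fun p : A × A × A => p.1 + p.2.1 - p.2.2) ↑(W ×ˢ X ×ˢ Y))
    (d₁₂ : Disjoint ((W ×ˢ X ×ˢ Y).image fun p : A × A × A => -p.1 + p.2.1 + p.2.2)
      ((W ×ˢ X ×ˢ Y).image fun p : A × A × A => p.1 - p.2.1 + p.2.2))
    (d₁₃ : Disjoint ((W ×ˢ X ×ˢ Y).image fun p : A × A × A => -p.1 + p.2.1 + p.2.2)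
      ((W ×ˢ X ×ˢ Y).image fun p : A × A × A => p.1 + p.2.1 - p.2.2))
    (d₂₃ : Disjoint ((W ×ˢ X ×ˢ Y).image fun p : A × A × A => p.1 - p.2.1 + p.2.2)
      ((W ×ˢ X ×ˢ Y).image fun p : A × A × A => p.1 + p.2.1 - p.2.2))
    (hcover : ((W ×ˢ X ×ˢ Y).image fun p : A × A × A => -p.1 + p.2.1 + p.2.2) ∪
      ((W ×ˢ X ×ˢ Y).image fun p : A × A × A => p.1 - p.2.1 + p.2.2) ∪
      ((W ×ˢ X ×ˢ Y).image fun p : A × A × A => p.1 + p.2.1 - p.2.2) = univ.erase x₀) :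
    let W' := W.image σ
    let X' := X.image σ
    let Y' := Y.image σ
    Set.InjOn (fun p : B × B × B => -p.1 + p.2.1 + p.2.2) ↑(W' ×ˢ X' ×ˢ Y') ∧
    Set.InjOn (fun p : B × B × B => p.1 - p.2.1 + p.2.2) ↑(W' ×ˢ X' ×ˢ Y') ∧
    Set.InjOn (fun p : B × B × B => p.1 + p.2.1 - p.2.2) ↑(W' ×ˢ X' ×ˢ Y') ∧
    Disjoint ((W' ×ˢ X' ×ˢ Y').image fun p : B × B × B => -p.1 + p.2.1 + p.2.2)
      ((W' ×ˢ X' ×ˢ Y').image fun p : B × B × B => p.1 - p.2.1 + p.2.2) ∧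
    Disjoint ((W' ×ˢ X' ×ˢ Y').image fun p : B × B × B => -p.1 + p.2.1 + p.2.2)
      ((W' ×ˢ X' ×ˢ Y').image fun p : B × B × B => p.1 + p.2.1 - p.2.2) ∧
    Disjoint ((W' ×ˢ X' ×ˢ Y').image fun p : B × B × B => p.1 - p.2.1 + p.2.2)
      ((W' ×ˢ X' ×ˢ Y').image fun p : B × B × B => p.1 + p.2.1 - p.2.2) ∧
    ((W' ×ˢ X' ×ˢ Y').image fun p : B × B × B => -p.1 + p.2.1 + p.2.2) ∪
      ((W' ×ˢ X' ×ˢ Y').image fun p : B × B × B => p.1 - p.2.1 + p.2.2) ∪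
      ((W' ×ˢ X' ×ˢ Y').image fun p : B × B × B => p.1 + p.2.1 - p.2.2) = univ.erase (σ x₀) ∧
    W'.card = W.card ∧ X'.card = X.card ∧ Y'.card = Y.card := by
  intro W' X' Y'
  have c₁ : ∀ p : A × A × A, (fun p : B × B × B => -p.1 + p.2.1 + p.2.2) (σ p.1, σ p.2.1, σ p.2.2) =
      (fun p : A × A × A => σ (-p.1 + p.2.1 + p.2.2)) p := fun p => by simp
  have c₂ : ∀ p : A × A × A, (fun p : B × B × B => p.1 - p.2.1 + p.2.2) (σ p.1, σ p.2.1, σ p.2.2) =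
      (fun p : A × A × A => σ (p.1 - p.2.1 + p.2.2)) p := fun p => by simp
  have c₃ : ∀ p : A × A × A, (fun p : B × B × B => p.1 + p.2.1 - p.2.2) (σ p.1, σ p.2.1, σ p.2.2) =
      (fun p : A × A × A => σ (p.1 + p.2.1 - p.2.2)) p := fun p => by simp
  -- `σ ∘ f` is injective on the box iff `f` is, and its image is `σ '' (image f)`
  have hinj : ∀ {f : A × A × A → A}, Set.InjOn f ↑(W ×ˢ X ×ˢ Y) →
      Set.InjOn (fun p : A × A × A => σ (f p)) ↑(W ×ˢ X ×ˢ Y) :=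
    fun hf p hp q hq h => hf hp hq (σ.injective h)
  have himg : ∀ f : A × A × A → A, (W ×ˢ X ×ˢ Y).image (fun p : A × A × A => σ (f p)) =
      ((W ×ˢ X ×ˢ Y).image f).image σ := fun f => by rw [image_image]; rfl
  have hW' : W' ×ˢ X' ×ˢ Y' = (W ×ˢ X ×ˢ Y).image fun p : A × A × A => (σ p.1, σ p.2.1, σ p.2.2) :=
    product₃_image_map σ.toAddMonoidHom W X Y
  rw [hW', image_image_of_comp _ c₁, image_image_of_comp _ c₂, image_image_of_comp _ c₃, himg, himg, himg]
  refine ⟨injOn_image_of_comp c₁ (hinj h₁), injOn_image_of_comp c₂ (hinj h₂),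
    injOn_image_of_comp c₃ (hinj h₃), (disjoint_image σ.injective).2 d₁₂, (disjoint_image σ.injective).2 d₁₃,
    (disjoint_image σ.injective).2 d₂₃, ?_, card_image_of_injective _ σ.injective,
    card_image_of_injective _ σ.injective, card_image_of_injective _ σ.injective⟩
  rw [← image_union, ← image_union, hcover]
  ext b
  simp only [mem_image, mem_erase, mem_univ, and_true, ne_eq]
  constructor
  · rintro ⟨a, ha, rfl⟩; exact fun h => ha (σ.injective h)
  · intro hb; exact ⟨σ.symm b, fun h => hb (by rw [← h, AddEquiv.apply_symm_apply]), σ.apply_symm_apply b⟩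

end Symmetry

section Plane

variable {p : ℕ} [Fact p.Prime]

/-- **A part of size three over `ℤ_p × ℤ_p` is a non-degenerate triangle.**  If `W = {0, u, v}` (three distinct points)
is a part of a cube symmetric form over `ℤ_p²`, then `det(u, v) ≠ 0`: otherwise `0, u, v` lie in the kernel of the
non-zero functional `z ↦ u₂z₁ − u₁z₂`, a proper subgroup, contradicting the coset lemma. [folklore] -/
theorem det_ne_zero_of_cube_form {W X Y : Finset (ZMod p × ZMod p)} {x₀ u v : ZMod p × ZMod p}
    (h₁ : Set.InjOn (fun q : (ZMod p × ZMod p) × (ZMod p × ZMod p) × (ZMod p × ZMod p) => -q.1 + q.2.1 + q.2.2)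
      ↑(W ×ˢ X ×ˢ Y))
    (h₂ : Set.InjOn (fun q : (ZMod p × ZMod p) × (ZMod p × ZMod p) × (ZMod p × ZMod p) => q.1 - q.2.1 + q.2.2)
      ↑(W ×ˢ X ×ˢ Y))
    (h₃ : Set.InjOn (fun q : (ZMod p × ZMod p) × (ZMod p × ZMod p) × (ZMod p × ZMod p) => q.1 + q.2.1 - q.2.2)
      ↑(W ×ˢ X ×ˢ Y))
    (d₁₂ : Disjoint ((W ×ˢ X ×ˢ Y).image fun q => -q.1 + q.2.1 + q.2.2) ((W ×ˢ X ×ˢ Y).image fun q => q.1 - q.2.1 + q.2.2))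
    (d₁₃ : Disjoint ((W ×ˢ X ×ˢ Y).image fun q => -q.1 + q.2.1 + q.2.2) ((W ×ˢ X ×ˢ Y).image fun q => q.1 + q.2.1 - q.2.2))
    (d₂₃ : Disjoint ((W ×ˢ X ×ˢ Y).image fun q => q.1 - q.2.1 + q.2.2) ((W ×ˢ X ×ˢ Y).image fun q => q.1 + q.2.1 - q.2.2))
    (hcover : ((W ×ˢ X ×ˢ Y).image fun q => -q.1 + q.2.1 + q.2.2) ∪ ((W ×ˢ X ×ˢ Y).image fun q => q.1 - q.2.1 + q.2.2) ∪
      ((W ×ˢ X ×ˢ Y).image fun q => q.1 + q.2.1 - q.2.2) = univ.erase x₀)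
    (hW : W = {0, u, v}) (hu : u ≠ 0) (hv : v ≠ 0) (huv : u ≠ v) : u.1 * v.2 - u.2 * v.1 ≠ 0 := by
  intro hdet
  let ℓ : ZMod p × ZMod p →+ ZMod p :=
    { toFun := fun z => u.2 * z.1 - u.1 * z.2
      map_zero' := by simp
      map_add' := fun a b => by simp only [Prod.fst_add, Prod.snd_add]; ring }
  have hℓ : ∀ z, ℓ z = u.2 * z.1 - u.1 * z.2 := fun z => rfl
  have hker : ℓ.ker ≠ ⊤ := by
    intro htop
    have m10 : ((1 : ZMod p), (0 : ZMod p)) ∈ ℓ.ker := by rw [htop]; exact AddSubgroup.mem_top _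
    have m01 : ((0 : ZMod p), (1 : ZMod p)) ∈ ℓ.ker := by rw [htop]; exact AddSubgroup.mem_top _
    rw [AddMonoidHom.mem_ker, hℓ] at m10 m01
    simp only [mul_one, mul_zero, sub_zero, zero_sub, neg_eq_zero] at m10 m01
    exact hu (Prod.ext m01 m10)
  have hWker : ∀ w ∈ W, w - 0 ∈ ℓ.ker := by
    intro w hw
    rw [sub_zero, AddMonoidHom.mem_ker, hℓ]
    rw [hW, mem_insert, mem_insert, mem_singleton] at hw
    rcases hw with rfl | rfl | rfl
    · simp
    · ring
    · linear_combination -hdet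
  have hc1 := card_eq_one_of_subset_coset h₁ h₂ h₃ d₁₂ d₁₃ d₂₃ hcover ℓ.ker hker 0 hWker
  have hc3 : W.card = 3 := by rw [hW]; exact card_eq_three.2 ⟨0, u, v, hu.symm, hv.symm, huv, rfl⟩
  omega

/-- A pair of vectors with non-zero determinant is mapped to the standard basis by a group automorphism of `ℤ_p²`
(the inverse matrix). [folklore] -/
theorem exists_addEquiv_apply_eq_basis (u v : ZMod p × ZMod p) (hdet : u.1 * v.2 - u.2 * v.1 ≠ 0) :
    ∃ σ : (ZMod p × ZMod p) ≃+ (ZMod p × ZMod p), σ u = (1, 0) ∧ σ v = (0, 1) := by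
  obtain ⟨E, hD⟩ : ∃ E : ZMod p, E * (u.1 * v.2 - u.2 * v.1) = 1 := ⟨_, inv_mul_cancel₀ hdet⟩
  let f : ZMod p × ZMod p → ZMod p × ZMod p := fun z =>
    (E * (v.2 * z.1 - v.1 * z.2), E * (-u.2 * z.1 + u.1 * z.2))
  let g : ZMod p × ZMod p → ZMod p × ZMod p := fun c => (c.1 * u.1 + c.2 * v.1, c.1 * u.2 + c.2 * v.2)
  have hf : ∀ z, f z = (E * (v.2 * z.1 - v.1 * z.2), E * (-u.2 * z.1 + u.1 * z.2)) := fun z => rfl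
  have hg : ∀ c, g c = (c.1 * u.1 + c.2 * v.1, c.1 * u.2 + c.2 * v.2) := fun c => rfl
  have hgf : ∀ z, g (f z) = z := fun z => by
    rw [hf, hg]; ext
    · linear_combination z.1 * hD
    · linear_combination z.2 * hD
  have hfg : ∀ c, f (g c) = c := fun c => by
    rw [hg, hf]; ext
    · linear_combination c.1 * hD
    · linear_combination c.2 * hD
  have hadd : ∀ a b, f (a + b) = f a + f b := fun a b => by
    rw [hf, hf, hf]; ext <;> simp only [Prod.fst_add, Prod.snd_add] <;> ring
  refine ⟨{ toFun := f, invFun := g, left_inv := hgf, right_inv := hfg, map_add' := hadd }, ?_, ?_⟩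
  · show f u = (1, 0)
    rw [hf]; ext
    · linear_combination hD
    · simp only; ring
  · show f v = (0, 1)
    rw [hf]; ext
    · simp only; ring
    · linear_combination hD

/-- **Normal form of a part of size three over `ℤ_p × ℤ_p`.**  If a cube symmetric form over `ℤ_p²` has a part `W`
with `|W| = 3`, then (after a translation and a group automorphism, `cube_symmetric_form_translate` +
`cube_symmetric_form_map`) there is a cube symmetric form with the SAME part sizes and `W = {0, e₁, e₂}`,
`e₁ = (1,0)`, `e₂ = (0,1)`: the punctured torus `ℤ_p² ∖ {x₀}` is partitioned into the `2|X||Y|` "up-triangles"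
`{0,e₁,e₂} + t`, `t ∈ (Y − X) ⊔ (X − Y)`, and the `|X||Y|` "down-triangles" `−{0,e₁,e₂} + m`, `m ∈ X + Y`. [folklore] -/
theorem cube_form_part_three_normal_form {W X Y : Finset (ZMod p × ZMod p)} {x₀ : ZMod p × ZMod p}
    (h₁ : Set.InjOn (fun q : (ZMod p × ZMod p) × (ZMod p × ZMod p) × (ZMod p × ZMod p) => -q.1 + q.2.1 + q.2.2)
      ↑(W ×ˢ X ×ˢ Y))
    (h₂ : Set.InjOn (fun q : (ZMod p × ZMod p) × (ZMod p × ZMod p) × (ZMod p × ZMod p) => q.1 - q.2.1 + q.2.2)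
      ↑(W ×ˢ X ×ˢ Y))
    (h₃ : Set.InjOn (fun q : (ZMod p × ZMod p) × (ZMod p × ZMod p) × (ZMod p × ZMod p) => q.1 + q.2.1 - q.2.2)
      ↑(W ×ˢ X ×ˢ Y))
    (d₁₂ : Disjoint ((W ×ˢ X ×ˢ Y).image fun q => -q.1 + q.2.1 + q.2.2) ((W ×ˢ X ×ˢ Y).image fun q => q.1 - q.2.1 + q.2.2))
    (d₁₃ : Disjoint ((W ×ˢ X ×ˢ Y).image fun q => -q.1 + q.2.1 + q.2.2) ((W ×ˢ X ×ˢ Y).image fun q => q.1 + q.2.1 - q.2.2))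
    (d₂₃ : Disjoint ((W ×ˢ X ×ˢ Y).image fun q => q.1 - q.2.1 + q.2.2) ((W ×ˢ X ×ˢ Y).image fun q => q.1 + q.2.1 - q.2.2))
    (hcover : ((W ×ˢ X ×ˢ Y).image fun q => -q.1 + q.2.1 + q.2.2) ∪ ((W ×ˢ X ×ˢ Y).image fun q => q.1 - q.2.1 + q.2.2) ∪
      ((W ×ˢ X ×ˢ Y).image fun q => q.1 + q.2.1 - q.2.2) = univ.erase x₀)
    (hW : W.card = 3) :
    ∃ (X' Y' : Finset (ZMod p × ZMod p)) (x₀' : ZMod p × ZMod p),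
      let W₀ : Finset (ZMod p × ZMod p) := {0, (1, 0), (0, 1)}
      Set.InjOn (fun q : (ZMod p × ZMod p) × (ZMod p × ZMod p) × (ZMod p × ZMod p) => -q.1 + q.2.1 + q.2.2)
        ↑(W₀ ×ˢ X' ×ˢ Y') ∧
      Set.InjOn (fun q : (ZMod p × ZMod p) × (ZMod p × ZMod p) × (ZMod p × ZMod p) => q.1 - q.2.1 + q.2.2)
        ↑(W₀ ×ˢ X' ×ˢ Y') ∧
      Set.InjOn (fun q : (ZMod p × ZMod p) × (ZMod p × ZMod p) × (ZMod p × ZMod p) => q.1 + q.2.1 - q.2.2)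
        ↑(W₀ ×ˢ X' ×ˢ Y') ∧
      Disjoint ((W₀ ×ˢ X' ×ˢ Y').image fun q => -q.1 + q.2.1 + q.2.2)
        ((W₀ ×ˢ X' ×ˢ Y').image fun q => q.1 - q.2.1 + q.2.2) ∧
      Disjoint ((W₀ ×ˢ X' ×ˢ Y').image fun q => -q.1 + q.2.1 + q.2.2)
        ((W₀ ×ˢ X' ×ˢ Y').image fun q => q.1 + q.2.1 - q.2.2) ∧
      Disjoint ((W₀ ×ˢ X' ×ˢ Y').image fun q => q.1 - q.2.1 + q.2.2)
        ((W₀ ×ˢ X' ×ˢ Y').image fun q => q.1 + q.2.1 - q.2.2) ∧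
      ((W₀ ×ˢ X' ×ˢ Y').image fun q => -q.1 + q.2.1 + q.2.2) ∪ ((W₀ ×ˢ X' ×ˢ Y').image fun q => q.1 - q.2.1 + q.2.2) ∪
        ((W₀ ×ˢ X' ×ˢ Y').image fun q => q.1 + q.2.1 - q.2.2) = univ.erase x₀' ∧
      X'.card = X.card ∧ Y'.card = Y.card := by
  obtain ⟨w₀, w₁, w₂, h01, h02, h12, hWeq⟩ := card_eq_three.1 hW
  -- translate so that `w₀ ↦ 0`
  obtain ⟨t₁, t₂, t₃, e₁₂, e₁₃, e₂₃, tcov, -, cX, cY⟩ :=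
    cube_symmetric_form_translate h₁ h₂ h₃ d₁₂ d₁₃ d₂₃ hcover (-w₀)
  have hWt : W.image (· + -w₀) = {0, w₁ + -w₀, w₂ + -w₀} := by
    rw [hWeq, image_insert, image_insert, image_singleton, add_neg_cancel]
  rw [hWt] at t₁ t₂ t₃ e₁₂ e₁₃ e₂₃ tcov
  have hu : w₁ + -w₀ ≠ 0 := fun h => h01 (by rw [← sub_eq_add_neg, sub_eq_zero] at h; exact h.symm)
  have hv : w₂ + -w₀ ≠ 0 := fun h => h02 (by rw [← sub_eq_add_neg, sub_eq_zero] at h; exact h.symm)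
  have huv : w₁ + -w₀ ≠ w₂ + -w₀ := fun h => h12 (add_right_cancel h)
  have hdet := det_ne_zero_of_cube_form t₁ t₂ t₃ e₁₂ e₁₃ e₂₃ tcov rfl hu hv huv
  obtain ⟨σ, hσu, hσv⟩ := exists_addEquiv_apply_eq_basis _ _ hdet
  -- apply `σ`
  obtain ⟨m₁, m₂, m₃, f₁₂, f₁₃, f₂₃, mcov, -, cX', cY'⟩ := cube_symmetric_form_map σ t₁ t₂ t₃ e₁₂ e₁₃ e₂₃ tcov
  have hWm : ({0, w₁ + -w₀, w₂ + -w₀} : Finset (ZMod p × ZMod p)).image σ = {0, (1, 0), (0, 1)} := by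
    rw [image_insert, image_insert, image_singleton, map_zero, hσu, hσv]
  rw [hWm] at m₁ m₂ m₃ f₁₂ f₁₃ f₂₃ mcov
  exact ⟨_, _, _, m₁, m₂, m₃, f₁₂, f₁₃, f₂₃, mcov, cX'.trans cX, cY'.trans cY⟩

/-- **Arithmetic corollary.**  A cube symmetric form over `ℤ_p × ℤ_p` with a part of size `3` has
`9|X||Y| + 1 = p²`; in particular `p² ≡ 1 (mod 9)`, i.e. `p ≡ ±1 (mod 9)`. [folklore] -/
theorem nine_mul_card_add_one_eq_sq {W X Y : Finset (ZMod p × ZMod p)} {x₀ : ZMod p × ZMod p}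
    (h₁ : Set.InjOn (fun q : (ZMod p × ZMod p) × (ZMod p × ZMod p) × (ZMod p × ZMod p) => -q.1 + q.2.1 + q.2.2)
      ↑(W ×ˢ X ×ˢ Y))
    (h₂ : Set.InjOn (fun q : (ZMod p × ZMod p) × (ZMod p × ZMod p) × (ZMod p × ZMod p) => q.1 - q.2.1 + q.2.2)
      ↑(W ×ˢ X ×ˢ Y))
    (h₃ : Set.InjOn (fun q : (ZMod p × ZMod p) × (ZMod p × ZMod p) × (ZMod p × ZMod p) => q.1 + q.2.1 - q.2.2)
      ↑(W ×ˢ X ×ˢ Y))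
    (d₁₂ : Disjoint ((W ×ˢ X ×ˢ Y).image fun q => -q.1 + q.2.1 + q.2.2) ((W ×ˢ X ×ˢ Y).image fun q => q.1 - q.2.1 + q.2.2))
    (d₁₃ : Disjoint ((W ×ˢ X ×ˢ Y).image fun q => -q.1 + q.2.1 + q.2.2) ((W ×ˢ X ×ˢ Y).image fun q => q.1 + q.2.1 - q.2.2))
    (d₂₃ : Disjoint ((W ×ˢ X ×ˢ Y).image fun q => q.1 - q.2.1 + q.2.2) ((W ×ˢ X ×ˢ Y).image fun q => q.1 + q.2.1 - q.2.2))
    (hcover : ((W ×ˢ X ×ˢ Y).image fun q => -q.1 + q.2.1 + q.2.2) ∪ ((W ×ˢ X ×ˢ Y).image fun q => q.1 - q.2.1 + q.2.2) ∪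
      ((W ×ˢ X ×ˢ Y).image fun q => q.1 + q.2.1 - q.2.2) = univ.erase x₀)
    (hW : W.card = 3) : 9 * (X.card * Y.card) + 1 = p ^ 2 ∧ p ^ 2 % 9 = 1 := by
  have h := three_mul_card_add_one_eq h₁ h₂ h₃ d₁₂ d₁₃ d₂₃ hcover
  rw [hW, Fintype.card_prod, ZMod.card, ← sq] at h
  have h9 : 9 * (X.card * Y.card) + 1 = p ^ 2 := by rw [← h]; ring
  exact ⟨h9, by omega⟩


end Plane

end Summit.MatrixMultiplication.OmegaCensus
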